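import Literature.MathematicalPhysics.QuantumFieldTheory.King1986.AliasSums

/-!
# `BalabanUV.Beta.GAN24.AliasTail` — binder row G-an2-4 / (CONV-C), road P1-fibre, typer row **P1-E3** (node N16e of
# `HOME/GAN24/Formal/DAG.md` v2): the KING-TYPE ALIAS **TAIL** bound (engine of SKELETON-P1 B2 `alias_tail`)

NOT IN PRINT; OUR PROOF ATTEMPT.  HONEST FRAMING (cell contract, verbatim): «discharging `BetaPertH` makes Bałaban's UV stability
UNCONDITIONAL — a real constructive-QFT result; it is NOT the continuum limit and NOT the Clay problem.»  HONEST DEPENDENCY (verbatim):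
«continuum YM on T⁴ ⇐ BetaPertH ∧ nine spine estimates (0/9 proved); BetaPertH ⇐ (D1) ∧ (D4) ∧ CAP+tail; G-an2-4 gates asym, D1 and
NE2/3/4.»  This module is a [folklore] ENGINE (integral test + product formula for box sums) in the currency of the tree's kernel
reproduction of King 1986 (4.22) (`Literature/…/King1986/AliasSums`: `aliasMaj`, `aliasBox`, `aliasTerm`, `alias_sum_le`); it
discharges NOTHING of (CONV-C)'s K-slot `GAN24.CombesThomas.ConvCK 3 Lc` by itself — it is the tail complement of the FULL alias-sum
bound, consumed by the typer rows P1-L08b / P1-L08e′ (capacitance limit `N → ∞`, dominated convergence over `ℤ^D`), P1-L09b and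
P1-L11a (B2: the aliases present at level `j+1` and absent at level `j` sit at `‖m‖∞ ≳ N/Lc`).  NOT `BetaPertH`, NOT continuum, NOT
Clay.  No `def … : Prop`, no cited fact beyond the imported reproduction, no wall binder; «not in print; our proof attempt».

## What is proved (Mathlib + `King1986.AliasSums` only; every constant explicit; `s > 1`, `|p| ≤ π` resp. `p ∈ [−π, π]^D`, `R ≥ 1`)
* §1 the integral test FROM `x₀ > 0`: `Σ_{i<a} (x₀ + i + 1)^{−s} ≤ x₀^{1−s}/(s−1)` (`sum_range_rpow_neg_tail_le`), hence
  `Σ_{R ≤ n < K} (n+1)^{−s} ≤ R^{1−s}/(s−1)` (`sum_Ico_rpow_neg_le`) — uniformly in the window `K`.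
* §2 ONE COORDINATE (row P1-E3 (i)): `Σ_{i ∈ [−K, K], |i| > R} aliasMaj s p i ≤ tailConst s · R^{1−s}` with
  **`tailConst s = 2π^{1−s}/(s−1)`** (`sum_aliasMaj_tail_le`), uniformly in `K` and `p` (King's majorant
  `aliasMaj s p i = π|p + 2πi|^{−s} ≤ π^{1−s}|i|^{−s}`, `aliasMaj_le`).
* §3 `D` COORDINATES (row P1-E3 (ii)): for the product weights, the aliases of the window `[−K, K]^D` with SOME coordinate
  beyond `R` (`‖j‖∞ > R`) contribute
  `Σ_{j ∈ aliasBox D K, ∃ν |j_ν| > R} Π_μ aliasMaj s (p_μ) (j_μ) ≤ D · tailConst s · R^{1−s} · (colConst s)^{D−1}`,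
  **`colConst s = 1 + 2π^{1−s}·s/(s−1)`** = the one-coordinate FULL-sum bound of `King1986.sum_aliasMaj_le`
  (`sum_prod_aliasMaj_tail_le`: union bound over the large coordinate + the product formula `Finset.prod_univ_sum`); the same
  for ANY finite family of far aliases (`sum_prod_aliasMaj_tail_le_of_subset`); and the CONSUMER CASE `s = 2` with the numbers
  displayed: `≤ D · (2/π) · (1 + 4/π)^{D−1} / R` (`sum_prod_aliasMaj_two_tail_le`) — the `C/R` tail of row P1-E3 (iii) for
  weights majorised coordinatewise by `aliasMaj 2` (squared sinc-type weights).
* §4 `aliasTerm` CURRENCY (row P1-E3 (iii)): for `d ≥ 1`, `α < 1`, King's isotropic splitting `s = 1 + (1−α)/d`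
  (`aliasTerm_le_prod_aliasMaj`) gives the tail exponent **`R^{−(1−α)/d}`** — stated AS OBTAINED, not better:
  `Σ_{j ∈ aliasBox d K, ‖j‖∞ > R} aliasTerm α p j ≤ d · tailConst s · (colConst s)^{d−1} · R^{−(1−α)/d}` (`alias_tail_sum_le`,
  `alias_tail_sum_le_of_subset`).  The consumer's `C/R` at `D = 4` is §3 with `s = 2`, NOT this corollary.

Unit `b2b-balaban-gan24-formalise-leaf-12` (G-an2-4 formalisation swarm, leaf prover 12), 2026-08-19.  Value = kernel engine toward the
K-slot route P1, NOT summit progress.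
-/

noncomputable section

open Real Finset

namespace Summit.QuantumFields.BalabanUV.Beta.GAN24.AliasTail

open Literature.MathematicalPhysics.QuantumFieldTheory.King1986

/-! ## §1  The integral test from `x₀ > 0` -/

/-- [folklore] Integral comparison from `x₀ > 0`: `Σ_{i<a} (x₀ + (i+1))^{−s} ≤ ∫_{x₀}^{x₀+a} x^{−s} dx ≤ x₀^{1−s}/(s−1)` for `s > 1`. -/
theorem sum_range_rpow_neg_tail_le {s : ℝ} (hs : 1 < s) {x₀ : ℝ} (hx : 0 < x₀) (a : ℕ) :
    ∑ i ∈ Finset.range a, (x₀ + ((i + 1 : ℕ) : ℝ)) ^ (-s) ≤ x₀ ^ (1 - s) / (s - 1) := by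
  have hanti : AntitoneOn (fun x : ℝ => x ^ (-s)) (Set.Icc x₀ (x₀ + a)) := by
    intro x hx' y _ hxy
    exact rpow_le_rpow_of_nonpos (by linarith [hx'.1]) hxy (by linarith)
  have h1 := AntitoneOn.sum_le_integral hanti
  have hint : ∫ x in x₀..(x₀ + a), x ^ (-s) = ((x₀ + a : ℝ) ^ (-s + 1) - x₀ ^ (-s + 1)) / (-s + 1) := by
    apply integral_rpow
    right
    refine ⟨by linarith, ?_⟩
    rw [Set.uIcc_of_le (by linarith [(Nat.cast_nonneg a : (0 : ℝ) ≤ a)] : x₀ ≤ x₀ + a)]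
    intro h
    exact absurd h.1 (not_le.2 hx)
  have hN0 : (0 : ℝ) ≤ (x₀ + a : ℝ) ^ (-s + 1) := rpow_nonneg (by positivity) _
  have hs1 : (0 : ℝ) < s - 1 := by linarith
  calc ∑ i ∈ Finset.range a, (x₀ + ((i + 1 : ℕ) : ℝ)) ^ (-s)
      ≤ ∫ x in x₀..(x₀ + a), x ^ (-s) := h1
    _ = ((x₀ + a : ℝ) ^ (-s + 1) - x₀ ^ (-s + 1)) / (-s + 1) := hint
    _ = (x₀ ^ (1 - s) - (x₀ + a : ℝ) ^ (-s + 1)) / (s - 1) := by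
        rw [← neg_div_neg_eq, show -s + 1 = 1 - s by ring]; ring_nf
    _ ≤ x₀ ^ (1 - s) / (s - 1) := by
        apply div_le_div_of_nonneg_right _ hs1.le
        linarith

/-- [folklore] `Σ_{R ≤ n < K} (n+1)^{−s} ≤ R^{1−s}/(s−1)` for `s > 1`, `R ≥ 1`, uniformly in `K`. -/
theorem sum_Ico_rpow_neg_le {s : ℝ} (hs : 1 < s) {R : ℕ} (hR : 1 ≤ R) (K : ℕ) :
    ∑ n ∈ Finset.Ico R K, ((n : ℝ) + 1) ^ (-s) ≤ (R : ℝ) ^ (1 - s) / (s - 1) := by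
  have hR0 : (0 : ℝ) < R := by exact_mod_cast hR
  rw [Finset.sum_Ico_eq_sum_range]
  have heq : ∑ k ∈ Finset.range (K - R), (((R + k : ℕ) : ℝ) + 1) ^ (-s)
      = ∑ i ∈ Finset.range (K - R), ((R : ℝ) + ((i + 1 : ℕ) : ℝ)) ^ (-s) :=
    Finset.sum_congr rfl fun i _ => by push_cast; ring_nf
  rw [heq]
  exact sum_range_rpow_neg_tail_le hs hR0 (K - R)

/-! ## §2  One coordinate: the tail of King's majorant sum -/

/-- The explicit TAIL constant `tailConst s = 2π^{1−s}/(s−1)` (two half-lines `i > R`, `i < −R`, each `≤ π^{1−s}·R^{1−s}/(s−1)`). -/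
def tailConst (s : ℝ) : ℝ := 2 * π ^ (1 - s) / (s - 1)

/-- [folklore] `0 ≤ tailConst s` for `s > 1`. -/
theorem tailConst_nonneg {s : ℝ} (hs : 1 < s) : 0 ≤ tailConst s :=
  div_nonneg (mul_nonneg zero_le_two (rpow_nonneg Real.pi_pos.le _)) (by linarith)

/-- The explicit one-coordinate FULL-SUM constant `colConst s = 1 + 2π^{1−s}·s/(s−1)` of `King1986.sum_aliasMaj_le`
(`Σ_{|i| ≤ K} aliasMaj s p i ≤ colConst s`). -/
def colConst (s : ℝ) : ℝ := 1 + 2 * π ^ (1 - s) * (s / (s - 1))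

/-- [folklore] `1 ≤ colConst s` for `s > 1` (in particular `0 ≤ colConst s`). -/
theorem one_le_colConst {s : ℝ} (hs : 1 < s) : 1 ≤ colConst s := by
  unfold colConst
  have : 0 ≤ 2 * π ^ (1 - s) * (s / (s - 1)) :=
    mul_nonneg (mul_nonneg zero_le_two (rpow_nonneg Real.pi_pos.le _)) (div_nonneg (by linarith) (by linarith))
  linarith

/-- [folklore] The one-coordinate full sum in `colConst` form: `Σ_{i ∈ [−K,K]} aliasMaj s p i ≤ colConst s`
(= `King1986.sum_aliasMaj_le` by name). -/
theorem sum_aliasMaj_le_colConst {s p : ℝ} (hs : 1 < s) (hp : |p| ≤ π) (K : ℕ) :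
    ∑ i ∈ Finset.Icc (-(K : ℤ)) K, aliasMaj s p i ≤ colConst s :=
  sum_aliasMaj_le hs hp K

/-- **ONE-COORDINATE ALIAS TAIL (row P1-E3 (i)).**  For `s > 1`, `|p| ≤ π`, `R ≥ 1` and every window `K`:
`Σ_{i ∈ [−K, K], |i| > R} aliasMaj s p i ≤ tailConst s · R^{1−s}` — uniformly in `K` and `p`.
[folklore; King 1986 (4.22) pattern, integral test started at `R`] -/
theorem sum_aliasMaj_tail_le {s p : ℝ} (hs : 1 < s) (hp : |p| ≤ π) {R : ℕ} (hR : 1 ≤ R) (K : ℕ) :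
    ∑ i ∈ (Finset.Icc (-(K : ℤ)) K).filter (fun i => (R : ℤ) < |i|), aliasMaj s p i
      ≤ tailConst s * (R : ℝ) ^ (1 - s) := by
  rw [Finset.sum_filter, sum_Icc_neg_eq]
  have h0 : ¬ ((R : ℤ) < |(0 : ℤ)|) := by simp
  rw [if_neg h0, zero_add]
  -- the pair `±(n+1)` contributes only when `n ≥ R`, and then at most `2π^{1−s}(n+1)^{−s}`
  have hterm : ∀ n : ℕ,
      ((if (R : ℤ) < |(n : ℤ) + 1| then aliasMaj s p ((n : ℤ) + 1) else 0)
        + (if (R : ℤ) < |-((n : ℤ) + 1)| then aliasMaj s p (-((n : ℤ) + 1)) else 0))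
      ≤ if R ≤ n then 2 * π ^ (1 - s) * ((n : ℝ) + 1) ^ (-s) else 0 := by
    intro n
    have habs1 : |(n : ℤ) + 1| = n + 1 := abs_of_nonneg (by positivity)
    have habs2 : |-((n : ℤ) + 1)| = n + 1 := by rw [abs_neg, habs1]
    rw [habs1, habs2]
    by_cases hn : R ≤ n
    · have hlt : (R : ℤ) < n + 1 := by omega
      rw [if_pos hlt, if_pos hlt, if_pos hn]
      have hne : ((n : ℤ) + 1) ≠ 0 := by omega
      have hne' : (-((n : ℤ) + 1)) ≠ 0 := by omega
      have h1 := aliasMaj_le (by linarith : 0 ≤ s) hp hne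
      have h2 := aliasMaj_le (by linarith : 0 ≤ s) hp hne'
      have hc : |(((n : ℤ) + 1 : ℤ) : ℝ)| = (n : ℝ) + 1 := by
        push_cast; rw [abs_of_nonneg (by positivity)]
      have hc' : |((-((n : ℤ) + 1) : ℤ) : ℝ)| = (n : ℝ) + 1 := by
        push_cast; rw [abs_neg, abs_of_nonneg (by positivity)]
      rw [hc] at h1
      rw [hc'] at h2
      linarith
    · have hlt : ¬ ((R : ℤ) < n + 1) := by omega
      rw [if_neg hlt, if_neg hlt, if_neg hn, add_zero]
  have hfilter : (Finset.range K).filter (fun n => R ≤ n) = Finset.Ico R K := by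
    ext n
    simp only [Finset.mem_filter, Finset.mem_range, Finset.mem_Ico]
    omega
  have hpos : 0 ≤ 2 * π ^ (1 - s) := mul_nonneg zero_le_two (rpow_nonneg Real.pi_pos.le _)
  calc ∑ n ∈ Finset.range K,
        ((if (R : ℤ) < |(n : ℤ) + 1| then aliasMaj s p ((n : ℤ) + 1) else 0)
          + (if (R : ℤ) < |-((n : ℤ) + 1)| then aliasMaj s p (-((n : ℤ) + 1)) else 0))
      ≤ ∑ n ∈ Finset.range K, (if R ≤ n then 2 * π ^ (1 - s) * ((n : ℝ) + 1) ^ (-s) else 0) :=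
        Finset.sum_le_sum fun n _ => hterm n
    _ = ∑ n ∈ (Finset.range K).filter (fun n => R ≤ n), 2 * π ^ (1 - s) * ((n : ℝ) + 1) ^ (-s) :=
        (Finset.sum_filter _ _).symm
    _ = 2 * π ^ (1 - s) * ∑ n ∈ Finset.Ico R K, ((n : ℝ) + 1) ^ (-s) := by
        rw [hfilter, Finset.mul_sum]
    _ ≤ 2 * π ^ (1 - s) * ((R : ℝ) ^ (1 - s) / (s - 1)) :=
        mul_le_mul_of_nonneg_left (sum_Ico_rpow_neg_le hs hR K) hpos
    _ = tailConst s * (R : ℝ) ^ (1 - s) := by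
        unfold tailConst
        have hs1 : (s - 1) ≠ 0 := (by linarith : (0 : ℝ) < s - 1).ne'
        field_simp

/-! ## §3  `D` coordinates: the far aliases of the box under product weights -/

variable {D : ℕ}

/-- [folklore] UNION BOUND over the large coordinate for NONNEGATIVE summands on the box:
`Σ_{j ∈ [−K,K]^D, ∃ν |j_ν| > R} f j ≤ Σ_ν Σ_{j ∈ [−K,K]^D, |j_ν| > R} f j`. -/
theorem sum_filter_exists_le_sum_sum_filter (K R : ℕ) (f : (Fin D → ℤ) → ℝ) (hf : ∀ j, 0 ≤ f j) :
    ∑ j ∈ (aliasBox D K).filter (fun j => ∃ ν, (R : ℤ) < |j ν|), f j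
      ≤ ∑ ν : Fin D, ∑ j ∈ (aliasBox D K).filter (fun j => (R : ℤ) < |j ν|), f j := by
  classical
  rw [Finset.sum_filter]
  have hswap : ∑ ν : Fin D, ∑ j ∈ (aliasBox D K).filter (fun j => (R : ℤ) < |j ν|), f j
      = ∑ j ∈ aliasBox D K, ∑ ν : Fin D, (if (R : ℤ) < |j ν| then f j else 0) := by
    rw [Finset.sum_comm]
    refine Finset.sum_congr rfl fun ν _ => ?_
    rw [Finset.sum_filter]
  rw [hswap]
  refine Finset.sum_le_sum fun j _ => ?_
  by_cases h : ∃ ν, (R : ℤ) < |j ν|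
  · rw [if_pos h]
    obtain ⟨ν, hν⟩ := h
    calc f j = (if (R : ℤ) < |j ν| then f j else 0) := by rw [if_pos hν]
      _ ≤ ∑ ν' : Fin D, (if (R : ℤ) < |j ν'| then f j else 0) :=
          Finset.single_le_sum (f := fun ν' : Fin D => if (R : ℤ) < |j ν'| then f j else 0)
            (fun ν' _ => by
              show 0 ≤ (if (R : ℤ) < |j ν'| then f j else 0)
              split_ifs
              · exact hf j
              · exact le_rfl) (Finset.mem_univ ν)
  · rw [if_neg h]
    exact Finset.sum_nonneg fun ν _ => by
      show 0 ≤ (if (R : ℤ) < |j ν| then f j else 0)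
      split_ifs
      · exact hf j
      · exact le_rfl

/-- [folklore] Filtering the box `[−K, K]^D` on ONE coordinate is again a product box (with that factor filtered). -/
theorem filter_aliasBox_coord (K : ℕ) (ν : Fin D) (Q : ℤ → Prop) [DecidablePred Q] :
    (aliasBox D K).filter (fun j => Q (j ν))
      = Fintype.piFinset (fun μ => if μ = ν then (Finset.Icc (-(K : ℤ)) K).filter Q else Finset.Icc (-(K : ℤ)) K) := by
  ext j
  simp only [aliasBox, Finset.mem_filter, Fintype.mem_piFinset]
  constructor
  · rintro ⟨hbox, hQ⟩ μ
    by_cases hμ : μ = ν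
    · subst hμ
      rw [if_pos rfl, Finset.mem_filter]
      exact ⟨hbox μ, hQ⟩
    · rw [if_neg hμ]
      exact hbox μ
  · intro h
    refine ⟨fun μ => ?_, ?_⟩
    · have hμ := h μ
      by_cases hμν : μ = ν
      · subst hμν
        rw [if_pos rfl, Finset.mem_filter] at hμ
        exact hμ.1
      · rw [if_neg hμν] at hμ
        exact hμ
    · have hν := h ν
      rw [if_pos rfl, Finset.mem_filter] at hν
      exact hν.2

/-- [folklore] ONE LARGE COORDINATE: the aliases of `[−K, K]^D` with `|j_ν| > R` (fixed `ν`) contribute at most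
`tailConst s · R^{1−s} · (colConst s)^{D−1}` — the box sum FACTORISES (`Finset.prod_univ_sum`) into the `ν`-tail times
`D − 1` full one-coordinate sums. -/
theorem sum_prod_aliasMaj_coord_tail_le {s : ℝ} (hs : 1 < s) {p : Fin D → ℝ} (hp : ∀ μ, |p μ| ≤ π)
    {R : ℕ} (hR : 1 ≤ R) (K : ℕ) (ν : Fin D) :
    ∑ j ∈ (aliasBox D K).filter (fun j => (R : ℤ) < |j ν|), ∏ μ, aliasMaj s (p μ) (j μ)
      ≤ tailConst s * (R : ℝ) ^ (1 - s) * colConst s ^ (D - 1) := by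
  classical
  rw [filter_aliasBox_coord K ν (fun i => (R : ℤ) < |i|), ← Finset.prod_univ_sum]
  -- each factor: the ν-factor is the tail, the others are full sums
  set b : Fin D → ℝ := fun μ => if μ = ν then tailConst s * (R : ℝ) ^ (1 - s) else colConst s with hb
  have hfac : ∀ μ, ∑ i ∈ (if μ = ν then (Finset.Icc (-(K : ℤ)) K).filter (fun i => (R : ℤ) < |i|)
        else Finset.Icc (-(K : ℤ)) K), aliasMaj s (p μ) i ≤ b μ := by
    intro μ
    by_cases hμ : μ = ν
    · simp only [hb, if_pos hμ]
      exact sum_aliasMaj_tail_le hs (hp μ) hR K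
    · simp only [hb, if_neg hμ]
      exact sum_aliasMaj_le_colConst hs (hp μ) K
  have hnonneg : ∀ μ, 0 ≤ ∑ i ∈ (if μ = ν then (Finset.Icc (-(K : ℤ)) K).filter (fun i => (R : ℤ) < |i|)
        else Finset.Icc (-(K : ℤ)) K), aliasMaj s (p μ) i :=
    fun μ => Finset.sum_nonneg fun i _ => aliasMaj_nonneg _ _ _
  calc ∏ μ, ∑ i ∈ (if μ = ν then (Finset.Icc (-(K : ℤ)) K).filter (fun i => (R : ℤ) < |i|)
          else Finset.Icc (-(K : ℤ)) K), aliasMaj s (p μ) i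
      ≤ ∏ μ, b μ := Finset.prod_le_prod (fun μ _ => hnonneg μ) fun μ _ => hfac μ
    _ = b ν * ∏ μ ∈ (Finset.univ : Finset (Fin D)).erase ν, b μ :=
        (Finset.mul_prod_erase _ _ (Finset.mem_univ ν)).symm
    _ = tailConst s * (R : ℝ) ^ (1 - s) * colConst s ^ (D - 1) := by
        have h1 : b ν = tailConst s * (R : ℝ) ^ (1 - s) := by simp [hb]
        have h2 : ∏ μ ∈ (Finset.univ : Finset (Fin D)).erase ν, b μ = colConst s ^ (D - 1) := by
          rw [Finset.prod_congr rfl (fun μ hμ => by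
            show b μ = colConst s
            simp only [hb, if_neg (Finset.ne_of_mem_erase hμ)])]
          rw [Finset.prod_const, Finset.card_erase_of_mem (Finset.mem_univ ν), Finset.card_univ, Fintype.card_fin]
        rw [h1, h2]

/-- **`D`-DIMENSIONAL ALIAS TAIL (row P1-E3 (ii)).**  For `s > 1`, `p ∈ [−π, π]^D`, `R ≥ 1` and every window `K`: the aliases
of `[−K, K]^D` with SOME coordinate beyond `R` (`‖j‖∞ > R`) satisfy
`Σ_{j, ∃ν |j_ν| > R} Π_μ aliasMaj s (p_μ) (j_μ) ≤ D · tailConst s · R^{1−s} · (colConst s)^{D−1}` — uniformly in `K` and `p`.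
[folklore; King 1986 (4.22) pattern] -/
theorem sum_prod_aliasMaj_tail_le {s : ℝ} (hs : 1 < s) {p : Fin D → ℝ} (hp : ∀ μ, |p μ| ≤ π)
    {R : ℕ} (hR : 1 ≤ R) (K : ℕ) :
    ∑ j ∈ (aliasBox D K).filter (fun j => ∃ ν, (R : ℤ) < |j ν|), ∏ μ, aliasMaj s (p μ) (j μ)
      ≤ D * (tailConst s * (R : ℝ) ^ (1 - s) * colConst s ^ (D - 1)) := by
  classical
  calc ∑ j ∈ (aliasBox D K).filter (fun j => ∃ ν, (R : ℤ) < |j ν|), ∏ μ, aliasMaj s (p μ) (j μ)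
      ≤ ∑ ν : Fin D, ∑ j ∈ (aliasBox D K).filter (fun j => (R : ℤ) < |j ν|), ∏ μ, aliasMaj s (p μ) (j μ) :=
        sum_filter_exists_le_sum_sum_filter K R _
          fun j => Finset.prod_nonneg fun μ _ => aliasMaj_nonneg _ _ _
    _ ≤ ∑ _ν : Fin D, tailConst s * (R : ℝ) ^ (1 - s) * colConst s ^ (D - 1) :=
        Finset.sum_le_sum fun ν _ => sum_prod_aliasMaj_coord_tail_le hs hp hR K ν
    _ = D * (tailConst s * (R : ℝ) ^ (1 - s) * colConst s ^ (D - 1)) := by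
        rw [Finset.sum_const, Finset.card_univ, Fintype.card_fin, nsmul_eq_mul]

/-- [folklore] Every finite family of integer vectors sits in a window `[−K, K]^D`. -/
theorem exists_subset_aliasBox (Λ : Finset (Fin D → ℤ)) : ∃ K : ℕ, Λ ⊆ aliasBox D K := by
  classical
  refine ⟨Λ.sup fun j => Finset.univ.sup fun μ => (j μ).natAbs, fun j hj => ?_⟩
  unfold aliasBox
  rw [Fintype.mem_piFinset]
  intro μ
  rw [Finset.mem_Icc]
  have h1 : (j μ).natAbs ≤ Finset.univ.sup fun μ => (j μ).natAbs :=
    Finset.le_sup (f := fun μ => (j μ).natAbs) (Finset.mem_univ μ)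
  have h2 : (Finset.univ.sup fun μ => (j μ).natAbs) ≤ Λ.sup fun j => Finset.univ.sup fun μ => (j μ).natAbs :=
    Finset.le_sup (f := fun j => Finset.univ.sup fun μ => (j μ).natAbs) hj
  have h : ((j μ).natAbs : ℤ) ≤ ((Λ.sup fun j => Finset.univ.sup fun μ => (j μ).natAbs : ℕ) : ℤ) := by
    exact_mod_cast h1.trans h2
  rw [Int.natCast_natAbs] at h
  exact abs_le.1 h

/-- **`D`-dimensional alias tail for ANY finite family of far aliases** (the form used downstream: the aliases present at level
`j+1` and absent at level `j`): if every `j ∈ Λ` has a coordinate with `|j_ν| > R` then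
`Σ_{j ∈ Λ} Π_μ aliasMaj s (p_μ) (j_μ) ≤ D · tailConst s · R^{1−s} · (colConst s)^{D−1}`. [folklore] -/
theorem sum_prod_aliasMaj_tail_le_of_subset {s : ℝ} (hs : 1 < s) {p : Fin D → ℝ} (hp : ∀ μ, |p μ| ≤ π)
    {R : ℕ} (hR : 1 ≤ R) {Λ : Finset (Fin D → ℤ)} (hfar : ∀ j ∈ Λ, ∃ ν, (R : ℤ) < |j ν|) :
    ∑ j ∈ Λ, ∏ μ, aliasMaj s (p μ) (j μ) ≤ D * (tailConst s * (R : ℝ) ^ (1 - s) * colConst s ^ (D - 1)) := by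
  classical
  obtain ⟨K, hK⟩ := exists_subset_aliasBox Λ
  have hsub : Λ ⊆ (aliasBox D K).filter (fun j => ∃ ν, (R : ℤ) < |j ν|) := fun j hj =>
    Finset.mem_filter.2 ⟨hK hj, hfar j hj⟩
  exact (Finset.sum_le_sum_of_subset_of_nonneg hsub fun j _ _ =>
    Finset.prod_nonneg fun μ _ => aliasMaj_nonneg _ _ _).trans (sum_prod_aliasMaj_tail_le hs hp hR K)

/-- [folklore] The consumer constants at `s = 2`: `tailConst 2 = 2/π` and `colConst 2 = 1 + 4/π`. -/
theorem tailConst_two : tailConst 2 = 2 / π := by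
  unfold tailConst
  rw [show (1 : ℝ) - 2 = -1 by norm_num, rpow_neg_one]
  field_simp
  ring

/-- [folklore] `colConst 2 = 1 + 4/π`. -/
theorem colConst_two : colConst 2 = 1 + 4 / π := by
  unfold colConst
  rw [show (1 : ℝ) - 2 = -1 by norm_num, rpow_neg_one]
  field_simp
  ring

/-- **THE CONSUMER CASE `s = 2` (row P1-E3 (iii), "tail `≤ C/R`").**  For weights majorised coordinatewise by `aliasMaj 2`
(squared sinc-type alias weights), `p ∈ [−π, π]^D`, `R ≥ 1`, every window `K`:
`Σ_{j ∈ [−K,K]^D, ‖j‖∞ > R} Π_μ aliasMaj 2 (p_μ) (j_μ) ≤ D · (2/π) · (1 + 4/π)^{D−1} / R`. [folklore] -/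
theorem sum_prod_aliasMaj_two_tail_le {p : Fin D → ℝ} (hp : ∀ μ, |p μ| ≤ π) {R : ℕ} (hR : 1 ≤ R) (K : ℕ) :
    ∑ j ∈ (aliasBox D K).filter (fun j => ∃ ν, (R : ℤ) < |j ν|), ∏ μ, aliasMaj 2 (p μ) (j μ)
      ≤ D * (2 / π) * (1 + 4 / π) ^ (D - 1) / R := by
  have h := sum_prod_aliasMaj_tail_le (s := 2) (by norm_num) hp hR K
  have hR0 : (0 : ℝ) < R := by exact_mod_cast hR
  rw [tailConst_two, colConst_two, show (1 : ℝ) - 2 = -1 by norm_num, rpow_neg_one] at h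
  calc _ ≤ (D : ℝ) * (2 / π * ((R : ℝ))⁻¹ * (1 + 4 / π) ^ (D - 1)) := h
    _ = D * (2 / π) * (1 + 4 / π) ^ (D - 1) / R := by
        field_simp

/-! ## §4  The `aliasTerm` currency of King (4.22): exponent `R^{−(1−α)/d}` -/

/-- [folklore] A far alias is a nonzero alias (`R ≥ 1 > 0`). -/
theorem ne_zero_of_far {d : ℕ} {R : ℕ} {j : Fin d → ℤ} (hfar : ∃ ν, (R : ℤ) < |j ν|) : j ≠ 0 := by
  obtain ⟨ν, hν⟩ := hfar
  intro h
  rw [h] at hν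
  simp at hν
  omega

/-- **ALIAS TAIL IN `aliasTerm` CURRENCY (row P1-E3 (iii); exponent AS OBTAINED).**  For `d ≥ 1`, `α < 1`,
`p ∈ [−π, π]^d`, `R ≥ 1`, every window `K`, with King's isotropic splitting `s = 1 + (1−α)/d`:
`Σ_{j ∈ [−K,K]^d, ‖j‖∞ > R} aliasTerm α p j ≤ d · tailConst s · (colConst s)^{d−1} · R^{−(1−α)/d}`.
The exponent `−(1−α)/d` (not `−(1−α)`) is the price of splitting `‖q‖^{α−1}` evenly over the `d` coordinates in
`aliasTerm_le_prod_aliasMaj`; the consumer's `C/R` at `D = 4` is `sum_prod_aliasMaj_two_tail_le`, not this corollary.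
[folklore; King 1986 (4.22) pattern] -/
theorem alias_tail_sum_le {d : ℕ} (hd : 0 < d) {α : ℝ} (hα : α < 1) {p : Fin d → ℝ} (hp : ∀ μ, |p μ| ≤ π)
    {R : ℕ} (hR : 1 ≤ R) (K : ℕ) :
    ∑ j ∈ (aliasBox d K).filter (fun j => ∃ ν, (R : ℤ) < |j ν|), aliasTerm α p j
      ≤ d * (tailConst (1 + (1 - α) / d) * (R : ℝ) ^ (-((1 - α) / d)) * colConst (1 + (1 - α) / d) ^ (d - 1)) := by
  classical
  set s : ℝ := 1 + (1 - α) / d with hs_def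
  have hs : 1 < s := by
    rw [hs_def]
    have : 0 < (1 - α) / (d : ℝ) := div_pos (by linarith) (by exact_mod_cast hd)
    linarith
  have hexp : -((1 - α) / (d : ℝ)) = 1 - s := by rw [hs_def]; ring
  rw [hexp]
  calc ∑ j ∈ (aliasBox d K).filter (fun j => ∃ ν, (R : ℤ) < |j ν|), aliasTerm α p j
      ≤ ∑ j ∈ (aliasBox d K).filter (fun j => ∃ ν, (R : ℤ) < |j ν|), ∏ μ, aliasMaj s (p μ) (j μ) :=
        Finset.sum_le_sum fun j hj =>
          aliasTerm_le_prod_aliasMaj hd hα.le hp (ne_zero_of_far (Finset.mem_filter.1 hj).2)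
    _ ≤ d * (tailConst s * (R : ℝ) ^ (1 - s) * colConst s ^ (d - 1)) := sum_prod_aliasMaj_tail_le hs hp hR K

/-- **The same for ANY finite family of far aliases** (`∀ j ∈ Λ, ∃ν |j_ν| > R`):
`Σ_{j ∈ Λ} aliasTerm α p j ≤ d · tailConst s · (colConst s)^{d−1} · R^{−(1−α)/d}`, `s = 1 + (1−α)/d`. [folklore] -/
theorem alias_tail_sum_le_of_subset {d : ℕ} (hd : 0 < d) {α : ℝ} (hα : α < 1) {p : Fin d → ℝ}
    (hp : ∀ μ, |p μ| ≤ π) {R : ℕ} (hR : 1 ≤ R) {Λ : Finset (Fin d → ℤ)} (hfar : ∀ j ∈ Λ, ∃ ν, (R : ℤ) < |j ν|) :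
    ∑ j ∈ Λ, aliasTerm α p j
      ≤ d * (tailConst (1 + (1 - α) / d) * (R : ℝ) ^ (-((1 - α) / d)) * colConst (1 + (1 - α) / d) ^ (d - 1)) := by
  classical
  obtain ⟨K, hK⟩ := exists_subset_aliasBox Λ
  have hsub : Λ ⊆ (aliasBox d K).filter (fun j => ∃ ν, (R : ℤ) < |j ν|) := fun j hj =>
    Finset.mem_filter.2 ⟨hK hj, hfar j hj⟩
  exact (Finset.sum_le_sum_of_subset_of_nonneg hsub fun j _ _ => aliasTerm_nonneg α p j).trans
    (alias_tail_sum_le hd hα hp hR K)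

end Summit.QuantumFields.BalabanUV.Beta.GAN24.AliasTail

end
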